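import Summits.BirchSwinnertonDyer.BirchSwinnertonDyer.Theorems.AlignedTransportAtTwoMainConjectureTransportAlignedAtTwoKilfordKernelLetterCrossLevelFactorMu
import Summits.BirchSwinnertonDyer.BirchSwinnertonDyer.Theorems.AlignedTransportAtTwoMainConjectureTransportAlignedAtTwoKilfordKernelLetterCrossLevelFactorPlusValue
import HarnessLib

/-!
# Crux C1 `MainConjectureTransportAlignedAtTwo` (stmt-BirchSwinnertonDyer-22296), line `birth`, residual (R2) `stub_lamLawKilford`, UNEQUAL
# conductors: ROW (r5) FOR GENERALISED OLD FORMS FROM `μ = 0` ALONE — III. the fold, the two-cusp `μ = 0` certificate, and the row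
# (width seat att-p4 g19; `--supports 22296`)

THEOREMS ONLY (no `def`, no `sorry`, no named fact, no instance). BSD is not proved by this; C1 is not closed by this.

* §3 the fold over a list of data `(ℓ, ρ_ℓ, σ_ℓ)` (odd primes `ℓ`) of the one-prime step of part I: the folded distribution keeps the distribution relation, bounds
  and evenness and has transform `ι(∏e_ℓ)·L_μ` (`fold_spec`, `fold_neg`); `∏e_ℓ` has unit content (`hasUnitContent_foldElement`); the folded TABLE
  `Ψ = (∏([1]+ρ_ℓ[ℓ]+σ_ℓ[ℓ²]))·[·]⁺_f` is `ℤ`-periodic and keeps the bound `2` on `2`-power cusps; the folded Mazur–Swinnerton-Dyer measure has the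
  Mazur–Swinnerton-Dyer shape in `Ψ` (`fold_msdMeasure_succ`).
* §4 **`exists_factorTable_sub_norm_gt_one`** — for `W` good ordinary at `2` without rational `2`-torsion abscissa, newform `f`, even-branch lift `G`: TWO
  `2`-power cusps with `‖Ψ(r₁) − Ψ(r₂)‖₂ > 1`. Otherwise the folded measure is `ℤ₂`-valued (`α⁻¹ ≡ 1 (mod 2)`: `norm_one_sub_inv_unitRoot_le_half`; `‖Ψ‖₂ ≤ 2`)
  and even, so its transform `ι(∏e_ℓ·G)` lies in `2Λ` — contradicting `μ(G) = 0` (the tree's `AnalyticMuTwo`) and the unit content of `∏e_ℓ` (part I §1).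
  The two-cusp form needs NO Hecke property of the old form (no `T_q`-transport of the cusp `0`).
* §5 **`exists_jacobiMapForm_factorForm_half_ne_zero`** — ROW (r5) for att-p3 g19's generalised old form `F`, `{∞,s}_F = ((∏_{ℓ∈S}([1]+ρ_ℓ[ℓ]+σ_ℓ[ℓ²]))·{∞,·}_f)(s)`
  (odd primes `ℓ`, any integer data with the level constraint, `L` odd, `F` lattice-compatible): some `y ∈ H₁(X₀(L);ℤ)` has `D.jacobiMapForm L F _ [y/2] ≠ O` —
  from the PRINT plus period unit, an even-branch lift, and a datum with odd Manin constant; part II does the homology. This is the `hnzᵢ` input of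
  `…KilfordKernelLetterCrossLevelCarrierForms.uniformize_twoForms_ker_iff_of_carrier` / att-p3 g19's level-`lcm` capstone for EVERY factor type (`1+V` at
  level-dividing primes, `1+V²`, `1+V+V²`), with no Ihara lemma (whose `ℓ²`-form, DDT Lemma 4.28 (b), is printed only for odd residue characteristic).

References: Mazur–Tate–Teitelbaum 1986 §I.10–I.13 [MazurTateTeitelbaum1986Invent]; Greenberg–Vatsal 2000 §1 (8)–(10), Prop. (2.4) [GreenbergVatsal2000];
Emerton–Pollack–Weston 2006 §3 (3.4)–(3.5) [EmertonPollackWeston2006]; Cremona 1997 §2.8, §2.10 [CremonaAlgorithms1997];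
Darmon–Diamond–Taylor 1995 Lemma 4.28 [DarmonDiamondTaylor1995].
-/

noncomputable section

-- justification: the `Summit.BirchSwinnertonDyer.BirchSwinnertonDyer.…` path repeats a component (route-file convention)
set_option linter.dupNamespace false
set_option autoImplicit false

open scoped MatrixGroups ModularForm NumberField Classical
open CongruenceSubgroup Complex WeierstrassCurve IsDedekindDomain PowerSeries
open Literature.NumberTheory.EllipticCurves Literature.NumberTheory.EllipticCurves.ModularForms
open Literature.NumberTheory.EllipticCurves.Greenberg1999 Literature.NumberTheory.EllipticCurves.GreenbergVatsal2000
open Summit.BirchSwinnertonDyer.Rank1Residual.F1Sign2 Summit.BirchSwinnertonDyer.Rank1Residual.X1.MuLambda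
open Summit.BirchSwinnertonDyer.Rank1Residual.X2.EulerFactorAlgebra
open Summit.BirchSwinnertonDyer.BirchSwinnertonDyer.Theorems.AlignedTransportAtTwoSigmaGlue
open Summit.BirchSwinnertonDyer.BirchSwinnertonDyer.Theorems.AlignedTransportAtTwoClosure
open Summit.BirchSwinnertonDyer.BirchSwinnertonDyer.Theorems.AlignedTransportAtTwoSigmaRaw
open Summit.BirchSwinnertonDyer.BirchSwinnertonDyer.Theorems.AlignedTransportAtTwoSymbolParity
open Summit.BirchSwinnertonDyer.BirchSwinnertonDyer.Theorems.AlignedTransportAtTwoOrdPlusLineTools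
open Summit.BirchSwinnertonDyer.BirchSwinnertonDyer.Theorems.AlignedTransportAtTwoOrdPlusLineOdd
open Summit.BirchSwinnertonDyer.BirchSwinnertonDyer.Theorems.AlignedTransportAtTwoKilfordKernelLetterCrossLevelFactorMu
open Summit.BirchSwinnertonDyer.BirchSwinnertonDyer.Theorems.AlignedTransportAtTwoKilfordKernelLetterCrossLevelFactorPlusValue

namespace Summit.BirchSwinnertonDyer.BirchSwinnertonDyer.Theorems.AlignedTransportAtTwoKilfordKernelLetterCrossLevelFactorMuCertificate

/-! ## §3 The fold over a list of data `(ℓ, ρ_ℓ, σ_ℓ)`: distributions, elements, tables -/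

section Fold

variable {μ : (n : ℕ) → ZMod (2 ^ n) → ℚ_[2]}

/-- **The folded distribution `(∏_t ([1] + ρ_t[ℓ_t]^* + σ_t[ℓ_t²]^*)) μ`** keeps the distribution relation and any bound, and has transform
`ι(∏_t e_{ℓ_t})·L_μ` (all `ℓ_t` odd). [cite: GreenbergVatsal2000, §1 p. 9 (display (8))] [cite: LangCyclotomic1990, Ch. 4 §2 (PDF pp. 80–82)] -/
theorem fold_spec (l : List (ℕ × ℤ × ℤ)) (hl : ∀ t ∈ l, (2 : ℕ).Coprime t.1)
    (hμ : ∀ (n : ℕ) (a : ZMod (2 ^ n)),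
      ∑ b ∈ Finset.univ.filter (fun b : ZMod (2 ^ (n + 1)) ↦
        ZMod.castHom (pow_dvd_pow 2 n.le_succ) (ZMod (2 ^ n)) b = a), μ (n + 1) b = μ n a)
    {C : ℝ} (hC : ∀ (n : ℕ) (a : ZMod (2 ^ n)), ‖μ n a‖ ≤ C) :
    (∀ (n : ℕ) (a : ZMod (2 ^ n)),
      ∑ b ∈ Finset.univ.filter (fun b : ZMod (2 ^ (n + 1)) ↦
        ZMod.castHom (pow_dvd_pow 2 n.le_succ) (ZMod (2 ^ n)) b = a), (List.foldr (fun (t : ℕ × ℤ × ℤ) (ν : (n : ℕ) → ZMod (2 ^ n) → ℚ_[2]) ↦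
        ν + (t.2.1 : ℚ_[2]) • codilate t.1 ν + (t.2.2 : ℚ_[2]) • codilate (t.1 ^ 2) ν) μ l) (n + 1) b = (List.foldr (fun (t : ℕ × ℤ × ℤ) (ν : (n : ℕ) → ZMod (2 ^ n) → ℚ_[2]) ↦
        ν + (t.2.1 : ℚ_[2]) • codilate t.1 ν + (t.2.2 : ℚ_[2]) • codilate (t.1 ^ 2) ν) μ l) n a) ∧
    (∀ (n : ℕ) (a : ZMod (2 ^ n)), ‖(List.foldr (fun (t : ℕ × ℤ × ℤ) (ν : (n : ℕ) → ZMod (2 ^ n) → ℚ_[2]) ↦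
        ν + (t.2.1 : ℚ_[2]) • codilate t.1 ν + (t.2.2 : ℚ_[2]) • codilate (t.1 ^ 2) ν) μ l) n a‖ ≤ C) ∧
    distributionTransform (List.foldr (fun (t : ℕ × ℤ × ℤ) (ν : (n : ℕ) → ZMod (2 ^ n) → ℚ_[2]) ↦
        ν + (t.2.1 : ℚ_[2]) • codilate t.1 ν + (t.2.2 : ℚ_[2]) • codilate (t.1 ^ 2) ν) μ l) = iwasawaToPowerSeries 2 (l.map fun (t : ℕ × ℤ × ℤ) ↦ (1 : IwasawaAlgebra 2) +
        (t.2.1 : IwasawaAlgebra 2) * PowerSeries.binomialSeries ℤ_[2] (-(frobeniusExponent 2 (t.1 : ℤ_[2]))) +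
        (t.2.2 : IwasawaAlgebra 2) * PowerSeries.binomialSeries ℤ_[2] (-(frobeniusExponent 2 (t.1 : ℤ_[2]))) ^ 2).prod * distributionTransform μ := by
  induction l with
  | nil =>
    refine ⟨hμ, hC, ?_⟩
    rw [List.foldr_nil, List.map_nil, List.prod_nil, map_one, one_mul]
  | cons t l ih =>
    obtain ⟨hd, hb, htr⟩ := ih (fun t' ht' ↦ hl t' (List.mem_cons_of_mem _ ht'))
    have ht := hl t List.mem_cons_self
    refine ⟨fun n a ↦ ?_, fun n a ↦ ?_, ?_⟩
    · simp only [List.foldr_cons]; exact step_distribution ht t.2.1 t.2.2 hd n a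
    · simp only [List.foldr_cons]; exact norm_step_le t.1 t.2.1 t.2.2 hb n a
    · simp only [List.foldr_cons, List.map_cons, List.prod_cons]
      rw [distributionTransform_step ht t.2.1 t.2.2 hd hb, htr, map_mul, mul_assoc]

/-- The folded distribution of an even set function is even. [cite: LangCyclotomic1990, Ch. 4 §2 (PDF pp. 80–82)] -/
theorem fold_neg (l : List (ℕ × ℤ × ℤ)) (hμ : ∀ (n : ℕ) (a : ZMod (2 ^ n)), μ n (-a) = μ n a) :
    ∀ (n : ℕ) (a : ZMod (2 ^ n)), (List.foldr (fun (t : ℕ × ℤ × ℤ) (ν : (n : ℕ) → ZMod (2 ^ n) → ℚ_[2]) ↦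
        ν + (t.2.1 : ℚ_[2]) • codilate t.1 ν + (t.2.2 : ℚ_[2]) • codilate (t.1 ^ 2) ν) μ l) n (-a) = (List.foldr (fun (t : ℕ × ℤ × ℤ) (ν : (n : ℕ) → ZMod (2 ^ n) → ℚ_[2]) ↦
        ν + (t.2.1 : ℚ_[2]) • codilate t.1 ν + (t.2.2 : ℚ_[2]) • codilate (t.1 ^ 2) ν) μ l) n a := by
  induction l with
  | nil => exact hμ
  | cons t l ih => intro n a; simp only [List.foldr_cons]; exact step_neg t.1 t.2.1 t.2.2 ih n a

/-- **`∏_t e_{ℓ_t}` has unit content** for a list of odd primes `ℓ_t` (unit content is multiplicative: `𝔽₂⟦T⟧` is a domain).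
[cite: GreenbergVatsal2000, §1 p. 9] -/
theorem hasUnitContent_foldElement (l : List (ℕ × ℤ × ℤ)) (hl : ∀ t ∈ l, t.1.Prime ∧ t.1 ≠ 2) : HasUnitContent (l.map fun (t : ℕ × ℤ × ℤ) ↦ (1 : IwasawaAlgebra 2) +
        (t.2.1 : IwasawaAlgebra 2) * PowerSeries.binomialSeries ℤ_[2] (-(frobeniusExponent 2 (t.1 : ℤ_[2]))) +
        (t.2.2 : IwasawaAlgebra 2) * PowerSeries.binomialSeries ℤ_[2] (-(frobeniusExponent 2 (t.1 : ℤ_[2]))) ^ 2).prod := by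
  induction l with
  | nil =>
    rw [List.map_nil, List.prod_nil]
    exact ⟨0, by rw [PowerSeries.coeff_zero_eq_constantCoeff, map_one]; exact isUnit_one⟩
  | cons t l ih =>
    rw [List.map_cons, List.prod_cons, hasUnitContent_mul_iff]
    exact ⟨hasUnitContent_factorElement (hl t List.mem_cons_self).1 (hl t List.mem_cons_self).2 t.2.1 t.2.2,
      ih (fun t' ht' ↦ hl t' (List.mem_cons_of_mem _ ht'))⟩

variable {φ : ℚ → ℚ}

/-- The folded table of a `ℤ`-periodic table is `ℤ`-periodic. [folklore] -/
theorem foldTable_add_intCast (l : List (ℕ × ℤ × ℤ)) (hφ : ∀ (x : ℚ) (z : ℤ), φ (x + z) = φ x) :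
    ∀ (x : ℚ) (z : ℤ), (List.foldr (fun (t : ℕ × ℤ × ℤ) (ψ : ℚ → ℚ) (x : ℚ) ↦
        ψ x + (t.2.1 : ℚ) * ψ ((t.1 : ℚ) * x) + (t.2.2 : ℚ) * ψ (((t.1 ^ 2 : ℕ) : ℚ) * x)) φ l) (x + z) = (List.foldr (fun (t : ℕ × ℤ × ℤ) (ψ : ℚ → ℚ) (x : ℚ) ↦
        ψ x + (t.2.1 : ℚ) * ψ ((t.1 : ℚ) * x) + (t.2.2 : ℚ) * ψ (((t.1 ^ 2 : ℕ) : ℚ) * x)) φ l) x := by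
  induction l with
  | nil => exact hφ
  | cons t l ih =>
    intro x z
    simp only [List.foldr_cons]
    have h1 : (t.1 : ℚ) * (x + z) = (t.1 : ℚ) * x + ((t.1 * z : ℤ) : ℚ) := by push_cast; ring
    have h2 : ((t.1 ^ 2 : ℕ) : ℚ) * (x + z) = ((t.1 ^ 2 : ℕ) : ℚ) * x + ((t.1 ^ 2 * z : ℤ) : ℚ) := by push_cast; ring
    rw [h1, h2, ih, ih, ih]

/-- A bound on the `2`-power cusps is preserved by the fold (integer weights, `ℓ^i·m/2ᵏ = (ℓ^i m)/2ᵏ`, ultrametric inequality).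
[cite: EmertonPollackWeston2006, §3 (3.4)–(3.5)] -/
theorem norm_foldTable_le (l : List (ℕ × ℤ × ℤ)) {B : ℝ} (hφ : ∀ m k : ℕ, ‖((φ ((m : ℚ) / (2 : ℚ) ^ k) : ℚ) : ℚ_[2])‖ ≤ B) :
    ∀ m k : ℕ, ‖(((List.foldr (fun (t : ℕ × ℤ × ℤ) (ψ : ℚ → ℚ) (x : ℚ) ↦
        ψ x + (t.2.1 : ℚ) * ψ ((t.1 : ℚ) * x) + (t.2.2 : ℚ) * ψ (((t.1 ^ 2 : ℕ) : ℚ) * x)) φ l) ((m : ℚ) / (2 : ℚ) ^ k) : ℚ) : ℚ_[2])‖ ≤ B := by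
  induction l with
  | nil => exact hφ
  | cons t l ih =>
    intro m k
    have hint : ∀ (z : ℤ) (x : ℚ_[2]), ‖x‖ ≤ B → ‖(z : ℚ_[2]) * x‖ ≤ B := fun z x hx ↦ by
      rw [norm_mul]
      calc _ ≤ 1 * B := mul_le_mul (Padic.norm_int_le_one z) hx (norm_nonneg _) zero_le_one
        _ = B := one_mul B
    have harg₁ : (t.1 : ℚ) * ((m : ℚ) / (2 : ℚ) ^ k) = ((t.1 * m : ℕ) : ℚ) / (2 : ℚ) ^ k := by push_cast; ring
    have harg₂ : ((t.1 ^ 2 : ℕ) : ℚ) * ((m : ℚ) / (2 : ℚ) ^ k) = ((t.1 ^ 2 * m : ℕ) : ℚ) / (2 : ℚ) ^ k := by push_cast; ring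
    have e₁ := ih (t.1 * m) k
    have e₂ := ih (t.1 ^ 2 * m) k
    rw [← harg₁] at e₁
    rw [← harg₂] at e₂
    simp only [List.foldr_cons, Rat.cast_add, Rat.cast_mul, Rat.cast_intCast]
    exact (Padic.nonarchimedean _ _).trans (max_le ((Padic.nonarchimedean _ _).trans (max_le (ih m k) (hint _ _ e₁))) (hint _ _ e₂))

variable {N : ℕ} [NeZero N] (f : CuspForm (Gamma0 N) 2)

/-- **The folded Mazur–Swinnerton-Dyer measure is the Mazur–Swinnerton-Dyer expression in the folded table**: at every positive level,
`((∏R_ℓ)·μ_{f,α})(a + 2^{n+1}ℤ₂) = α^{−(n+1)}Ψ(a/2^{n+1}) − α^{−(n+2)}Ψ(a/2ⁿ)` with `Ψ = (∏R_ℓ)·[·]⁺_f` (translation invariance of `[·]⁺_f`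
moves the representative of `a·ℓ^i`). [cite: MazurTateTeitelbaum1986Invent, §I.10 (10.1)] [cite: EmertonPollackWeston2006, §3 (3.4)–(3.5)] -/
theorem fold_msdMeasure_succ (l : List (ℕ × ℤ × ℤ)) (α : ℚ_[2]) :
    ∀ (n : ℕ) (a : ZMod (2 ^ (n + 1))),
      (List.foldr (fun (t : ℕ × ℤ × ℤ) (ν : (n : ℕ) → ZMod (2 ^ n) → ℚ_[2]) ↦
        ν + (t.2.1 : ℚ_[2]) • codilate t.1 ν + (t.2.2 : ℚ_[2]) • codilate (t.1 ^ 2) ν) (msdMeasure f α) l) (n + 1) a =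
        α⁻¹ ^ (n + 1) * ((List.foldr (fun (t : ℕ × ℤ × ℤ) (ψ : ℚ → ℚ) (x : ℚ) ↦
          ψ x + (t.2.1 : ℚ) * ψ ((t.1 : ℚ) * x) + (t.2.2 : ℚ) * ψ (((t.1 ^ 2 : ℕ) : ℚ) * x)) (ratPlusSymbol f) l
            ((a.val : ℚ) / (2 : ℚ) ^ (n + 1)) : ℚ) : ℚ_[2]) -
          α⁻¹ ^ (n + 2) * ((List.foldr (fun (t : ℕ × ℤ × ℤ) (ψ : ℚ → ℚ) (x : ℚ) ↦
          ψ x + (t.2.1 : ℚ) * ψ ((t.1 : ℚ) * x) + (t.2.2 : ℚ) * ψ (((t.1 ^ 2 : ℕ) : ℚ) * x)) (ratPlusSymbol f) l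
            ((a.val : ℚ) / (2 : ℚ) ^ n) : ℚ) : ℚ_[2]) := by
  induction l with
  | nil => intro n a; rfl
  | cons t l ih =>
    intro n a
    have hper := foldTable_add_intCast l (φ := ratPlusSymbol f) (fun x z ↦ ratPlusSymbol_add_intCast_eq f x z)
    simp only [List.foldr_cons]
    rw [step_apply, ih n, ih n, ih n]
    -- move the representatives: `(a d).val ≡ a.val d (mod 2^{n+1})` for `d = ℓ, ℓ²`
    haveI : NeZero (2 ^ (n + 1)) := ⟨pow_ne_zero _ two_ne_zero⟩
    have hmove : ∀ d : ℕ, ∃ z : ℤ, (((a * (d : ZMod (2 ^ (n + 1)))).val : ℚ)) = (a.val : ℚ) * (d : ℚ) - (2 : ℚ) ^ (n + 1) * z := by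
      intro d
      have hx : ((((a * (d : ZMod (2 ^ (n + 1)))).val : ℤ) : ZMod (2 ^ (n + 1)))) = (((a.val * d : ℕ) : ℤ) : ZMod (2 ^ (n + 1))) := by
        push_cast
        rw [ZMod.natCast_zmod_val, ZMod.natCast_zmod_val]
      obtain ⟨z, hz⟩ := (ZMod.intCast_eq_intCast_iff_dvd_sub _ _ _).mp hx
      refine ⟨z, ?_⟩
      have hzZ : (((a * (d : ZMod (2 ^ (n + 1)))).val : ℤ)) = (a.val : ℤ) * (d : ℤ) - (2 : ℤ) ^ (n + 1) * z := by
        push_cast at hz ⊢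
        linear_combination -hz
      exact_mod_cast hzZ
    obtain ⟨z₁, hz₁⟩ := hmove t.1
    obtain ⟨z₂, hz₂⟩ := hmove (t.1 ^ 2)
    have h11 : (((a * (t.1 : ZMod (2 ^ (n + 1)))).val : ℚ)) / (2 : ℚ) ^ (n + 1) =
        (t.1 : ℚ) * ((a.val : ℚ) / (2 : ℚ) ^ (n + 1)) + ((-z₁ : ℤ) : ℚ) := by
      rw [hz₁]; push_cast; field_simp; ring
    have h12 : (((a * (t.1 : ZMod (2 ^ (n + 1)))).val : ℚ)) / (2 : ℚ) ^ n =
        (t.1 : ℚ) * ((a.val : ℚ) / (2 : ℚ) ^ n) + ((-(2 * z₁) : ℤ) : ℚ) := by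
      rw [hz₁]; push_cast; field_simp; ring
    have h21 : (((a * ((t.1 ^ 2 : ℕ) : ZMod (2 ^ (n + 1)))).val : ℚ)) / (2 : ℚ) ^ (n + 1) =
        ((t.1 ^ 2 : ℕ) : ℚ) * ((a.val : ℚ) / (2 : ℚ) ^ (n + 1)) + ((-z₂ : ℤ) : ℚ) := by
      rw [hz₂]; push_cast; field_simp; ring
    have h22 : (((a * ((t.1 ^ 2 : ℕ) : ZMod (2 ^ (n + 1)))).val : ℚ)) / (2 : ℚ) ^ n =
        ((t.1 ^ 2 : ℕ) : ℚ) * ((a.val : ℚ) / (2 : ℚ) ^ n) + ((-(2 * z₂) : ℤ) : ℚ) := by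
      rw [hz₂]; push_cast; field_simp; ring
    rw [h11, h12, h21, h22, hper, hper, hper, hper]
    push_cast
    ring

end Fold


/-! ## §4 The factor `μ = 0` certificate: two `2`-power cusps whose folded table values differ by a non-integer -/

section MuCertificate

variable {N : ℕ} [NeZero N] {f : CuspForm (Gamma0 N) 2} (W : WeierstrassCurve ℚ) [W.IsElliptic] [W.IsGloballyMinimal]

omit [W.IsElliptic] in
/-- **`α⁻¹ ≡ 1 (mod 2)` for the unit root at a good ordinary `2`**: `α(α − a₂) = −2` gives `‖α − a₂‖ = ½`, and `a₂` is odd. [cite: MazurTateTeitelbaum1986Invent, §I.11] -/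
theorem norm_one_sub_inv_unitRoot_le_half (hord : IsOrdinaryAt W 2) : ‖1 - ((unitRoot W 2 : ℚ_[2]))⁻¹‖ ≤ 2⁻¹ := by
  obtain ⟨hαeq, hαu, hα0⟩ := unitRoot_coe_spec (W := W) hord
  set α : ℚ_[2] := (unitRoot W 2 : ℚ_[2]) with hα
  have ho : Odd (W.frobeniusTrace 2) := Int.not_even_iff_odd.mp fun h ↦ hord.2 (by exact_mod_cast even_iff_two_dvd.mp h)
  have h2 : ‖(2 : ℚ_[2])‖ = 2⁻¹ := by
    have h := @Padic.norm_p 2 _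
    push_cast at h
    exact h
  -- `α − a₂ = −2/α`
  have hdiff : α - ((W.frobeniusTrace 2 : ℤ) : ℚ_[2]) = -2 * α⁻¹ := by
    have h : α * (α - ((W.frobeniusTrace 2 : ℤ) : ℚ_[2])) = -2 := by
      have h2' : ((2 : ℕ) : ℚ_[2]) = 2 := by norm_num
      rw [h2'] at hαeq
      linear_combination hαeq
    field_simp
    linear_combination h
  have hn₁ : ‖α - ((W.frobeniusTrace 2 : ℤ) : ℚ_[2])‖ ≤ 2⁻¹ := by
    rw [hdiff, norm_mul, norm_neg, h2, norm_inv, hαu, inv_one, mul_one]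
  have hn₂ : ‖((W.frobeniusTrace 2 : ℤ) : ℚ_[2]) - 1‖ ≤ 2⁻¹ := by
    have h := norm_le_half_of_even (Odd.sub_odd ho odd_one)
    push_cast at h
    exact h
  have hn : ‖α - 1‖ ≤ 2⁻¹ := by
    have hsplit : α - 1 = (α - ((W.frobeniusTrace 2 : ℤ) : ℚ_[2])) + (((W.frobeniusTrace 2 : ℤ) : ℚ_[2]) - 1) := by ring
    rw [hsplit]
    exact (Padic.nonarchimedean _ _).trans (max_le hn₁ hn₂)
  have hrew : 1 - α⁻¹ = α⁻¹ * (α - 1) := by field_simp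
  rw [hrew, norm_mul, norm_inv, hαu, inv_one, one_mul]
  exact hn

/-- **The factor `μ = 0` certificate.** For `W` good ordinary at `2` without rational `2`-torsion abscissa, its newform `f`, an even-branch lift `G` and a list
`l` of data `(ℓ, ρ_ℓ, σ_ℓ)` with odd primes `ℓ`: there are TWO `2`-power cusps `m/2ᵏ`, `m'/2^{k'}` at which the folded table `Ψ = (∏([1]+ρ_ℓ[ℓ]+σ_ℓ[ℓ²]))·[·]⁺_f`
takes values differing by a NON-`2`-integral rational. Otherwise the folded Mazur–Swinnerton-Dyer measure `(∏R_ℓ)·μ_{f,α}` is `ℤ₂`-valued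
(`μ(a+2^{n+1}) = α^{−(n+1)}(Ψ(a/2^{n+1}) − Ψ(a/2ⁿ)) + α^{−(n+1)}(1 − α⁻¹)Ψ(a/2ⁿ)`, `α⁻¹ ≡ 1 (mod 2)`, `‖Ψ‖₂ ≤ 2`) and even, so its transform
`ι(∏e_ℓ·G)` lies in `2Λ` — contradicting `μ(G) = 0` (the tree's `AnalyticMuTwo`) and the unit content of `∏e_ℓ` (§1). No Hecke property of the old form and no
Ihara lemma is used. [cite: MazurTateTeitelbaum1986Invent, §I.10 (10.1) and §I.13] [cite: GreenbergVatsal2000, §1 (8)–(10) and Prop. (2.4)] -/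
theorem exists_factorTable_sub_norm_gt_one (hord : IsOrdinaryAt W 2) (ht : ∀ x : ℚ, ¬ HasRationalTwoTorsionX W x) (hf : IsNewformOf W f)
    (l : List (ℕ × ℤ × ℤ)) (hl : ∀ t ∈ l, t.1.Prime ∧ t.1 ≠ 2) {G : IwasawaAlgebra 2} (hG : IsEvenBranchLiftAtTwo W f G) :
    ∃ m k m' k' : ℕ, 1 < ‖(((List.foldr (fun (t : ℕ × ℤ × ℤ) (ψ : ℚ → ℚ) (x : ℚ) ↦
        ψ x + (t.2.1 : ℚ) * ψ ((t.1 : ℚ) * x) + (t.2.2 : ℚ) * ψ (((t.1 ^ 2 : ℕ) : ℚ) * x)) (ratPlusSymbol f) l) ((m : ℚ) / (2 : ℚ) ^ k) - (List.foldr (fun (t : ℕ × ℤ × ℤ) (ψ : ℚ → ℚ) (x : ℚ) ↦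
        ψ x + (t.2.1 : ℚ) * ψ ((t.1 : ℚ) * x) + (t.2.2 : ℚ) * ψ (((t.1 ^ 2 : ℕ) : ℚ) * x)) (ratPlusSymbol f) l) ((m' : ℚ) / (2 : ℚ) ^ k') : ℚ) : ℚ_[2])‖ := by
  by_contra hall
  push Not at hall
  have hlcop : ∀ t ∈ l, (2 : ℕ).Coprime t.1 := fun t ht' ↦ (Nat.coprime_primes Nat.prime_two (hl t ht').1).mpr (hl t ht').2.symm
  -- `red (∏e·G) ≠ 0`
  have hredG : red G ≠ 0 :=
    Summit.BirchSwinnertonDyer.BirchSwinnertonDyer.Theorems.AnalyticMuTwo.red_ne_zero_of_isEvenBranchLiftAtTwo_of_forall_not_hasRationalTwoTorsionX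
      W hord ht f hf G hG
  have hred : red ((l.map fun (t : ℕ × ℤ × ℤ) ↦ (1 : IwasawaAlgebra 2) +
        (t.2.1 : IwasawaAlgebra 2) * PowerSeries.binomialSeries ℤ_[2] (-(frobeniusExponent 2 (t.1 : ℤ_[2]))) +
        (t.2.2 : IwasawaAlgebra 2) * PowerSeries.binomialSeries ℤ_[2] (-(frobeniusExponent 2 (t.1 : ℤ_[2]))) ^ 2).prod * G) ≠ 0 := by
    rw [red_mul]
    exact mul_ne_zero (red_ne_zero_of_hasUnitContent (hasUnitContent_foldElement l hl)) hredG
  apply hred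
  -- the measure `μ_{f,α}` and its fold
  have hι := iwasawaToPowerSeries_eq_of_isEvenBranchLiftAtTwo_of_isOrdinaryAt W hord hG
  have hirr := irr_two_of_forall_not_hasRationalTwoTorsionX W ht
  obtain ⟨n₁, h2n₁, h01⟩ := exists_intCast_mul_modularSymbol_zero_mem (p := 2) not_irreducible_of_frobeniusTrace_congr_holds hf hirr
  have hd := msdMeasure_distribution_of_isNewformOf hord hf
  have hb := norm_msdMeasure_two_le_two hord hf h2n₁ h01
  obtain ⟨hdD, -, htD⟩ := fold_spec (μ := msdMeasure f (unitRoot W 2 : ℚ_[2])) l hlcop hd hb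
  have heD := fold_neg (μ := msdMeasure f (unitRoot W 2 : ℚ_[2])) l (msdMeasure_neg f (unitRoot W 2 : ℚ_[2]))
  have hvD := fold_msdMeasure_succ f l (unitRoot W 2 : ℚ_[2])
  set D := (List.foldr (fun (t : ℕ × ℤ × ℤ) (ν : (n : ℕ) → ZMod (2 ^ n) → ℚ_[2]) ↦
        ν + (t.2.1 : ℚ_[2]) • codilate t.1 ν + (t.2.2 : ℚ_[2]) • codilate (t.1 ^ 2) ν) (msdMeasure f (unitRoot W 2 : ℚ_[2])) l) with hD
  have hT : distributionTransform D = iwasawaToPowerSeries 2 ((l.map fun (t : ℕ × ℤ × ℤ) ↦ (1 : IwasawaAlgebra 2) +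
        (t.2.1 : IwasawaAlgebra 2) * PowerSeries.binomialSeries ℤ_[2] (-(frobeniusExponent 2 (t.1 : ℤ_[2]))) +
        (t.2.2 : IwasawaAlgebra 2) * PowerSeries.binomialSeries ℤ_[2] (-(frobeniusExponent 2 (t.1 : ℤ_[2]))) ^ 2).prod * G) := by
    rw [htD, ← padicLFunction_eq_distributionTransform, ← hι, map_mul]
  -- the table bound `‖Ψ(m/2ᵏ)‖ ≤ 2`
  have hreal : ∀ n, (cuspCoeff f n).im = 0 := cuspCoeff_im_eq_zero_of_coeffField_eq_bot hf.coeffField_eq_bot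
  have hpN : ¬ 2 ∣ N := not_dvd_level_of_isNewformOf hf hord.1
  have hsym : ∀ m k : ℕ, ‖((ratPlusSymbol f ((m : ℚ) / (2 : ℚ) ^ k) : ℚ) : ℚ_[2])‖ ≤ 2 := fun m k ↦ by
    have h := norm_ratPlusSymbol_two_le_two f hreal h2n₁ h01 (coprime_den_div_prime_pow hpN m k)
    exact_mod_cast h
  have hΨ := norm_foldTable_le l (φ := ratPlusSymbol f) hsym
  -- `‖α⁻¹‖ = 1`, `‖1 − α⁻¹‖ ≤ ½`
  have hαu : ‖((unitRoot W 2 : ℚ_[2]))⁻¹‖ = 1 := by rw [norm_inv, (unitRoot_coe_spec (W := W) hord).2.1, inv_one]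
  have hpow : ∀ j : ℕ, ‖((unitRoot W 2 : ℚ_[2]))⁻¹ ^ j‖ = 1 := fun j ↦ by rw [norm_pow, hαu, one_pow]
  have h1α := norm_one_sub_inv_unitRoot_le_half W hord
  -- the fold is `ℤ₂`-valued
  have hsucc : ∀ (n : ℕ) (a : ZMod (2 ^ (n + 1))), ‖D (n + 1) a‖ ≤ 1 := by
    intro n a
    rw [hvD n a]
    set α' : ℚ_[2] := ((unitRoot W 2 : ℚ_[2]))⁻¹ with hα'
    set x : ℚ := (List.foldr (fun (t : ℕ × ℤ × ℤ) (ψ : ℚ → ℚ) (x : ℚ) ↦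
        ψ x + (t.2.1 : ℚ) * ψ ((t.1 : ℚ) * x) + (t.2.2 : ℚ) * ψ (((t.1 ^ 2 : ℕ) : ℚ) * x)) (ratPlusSymbol f) l) ((a.val : ℚ) / (2 : ℚ) ^ (n + 1)) with hx
    set y : ℚ := (List.foldr (fun (t : ℕ × ℤ × ℤ) (ψ : ℚ → ℚ) (x : ℚ) ↦
        ψ x + (t.2.1 : ℚ) * ψ ((t.1 : ℚ) * x) + (t.2.2 : ℚ) * ψ (((t.1 ^ 2 : ℕ) : ℚ) * x)) (ratPlusSymbol f) l) ((a.val : ℚ) / (2 : ℚ) ^ n) with hy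
    have hsplit : α' ^ (n + 1) * ((x : ℚ) : ℚ_[2]) - α' ^ (n + 2) * ((y : ℚ) : ℚ_[2]) =
        α' ^ (n + 1) * (((x - y : ℚ)) : ℚ_[2]) + α' ^ (n + 1) * (1 - α') * ((y : ℚ) : ℚ_[2]) := by
      push_cast; ring
    rw [hsplit]
    refine (Padic.nonarchimedean _ _).trans (max_le ?_ ?_)
    · rw [norm_mul, hpow, one_mul, hx, hy]
      exact hall a.val (n + 1) a.val n
    · rw [norm_mul, norm_mul, hpow, one_mul, hy]
      calc ‖1 - α'‖ * _ ≤ 2⁻¹ * 2 := mul_le_mul h1α (hΨ a.val n) (norm_nonneg _) (by norm_num)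
        _ = 1 := by norm_num
  have hbD : ∀ (n : ℕ) (a : ZMod (2 ^ n)), ‖D n a‖ ≤ 1 := by
    intro n a
    cases n with
    | zero =>
      rw [← hdD 0 a]
      exact IsUltrametricDist.norm_sum_le_of_forall_le_of_nonneg zero_le_one fun b _ ↦ hsucc 0 b
    | succ n => exact hsucc n a
  -- hence its transform has coefficients in `2ℤ₂`
  have hcoeff : ∀ k : ℕ, ‖PowerSeries.coeff k (distributionTransform D)‖ ≤ 1 / 2 :=
    norm_coeff_distributionTransform_le_half_of_even heD hdD hbD
  refine (red_eq_of_norm_coeff_sub_le_half fun k ↦ ?_).trans (map_zero _)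
  rw [map_zero, map_zero, sub_zero, ← hT]
  have h := hcoeff k
  norm_num at h ⊢
  exact h

end MuCertificate


/-! ## §5 Row (r5) for the generalised old form -/

section Row

/-- **ROW (r5) FOR THE GENERALISED OLD FORM FROM `μ = 0` ALONE.** `W` good ordinary at `2` without rational `2`-torsion abscissa, `f` its newform, `G` an
even-branch lift, `D` a parametrisation datum at the conductor level with ODD Manin constant, the plus period unit at `2` (PRINT
`realPeriodRat_eq_unit_mul_plusPeriod_two`); `S` a set of ODD primes with integer data `(ρ_ℓ, σ_ℓ, e_ℓ)` (`ρ_ℓ = 0` unless `e_ℓ ≥ 1`, `σ_ℓ = 0` unless `e_ℓ ≥ 2`),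
an ODD level `L` with `N_W·∏ℓ^{e_ℓ} ∣ L`, and ANY `F ∈ S₂(Γ₀(L))` with `{∞, s}_F = ((∏_{ℓ∈S}([1] + ρ_ℓ[ℓ] + σ_ℓ[ℓ²]))·{∞,·}_{D.f})(s)`, lattice-compatible
(`hg`, e.g. `…KilfordCopyCrossLevelFactor.factorForm_mul_apply_mem`). THEN some `y ∈ H₁(X₀(L);ℤ)` has `D.jacobiMapForm L F hg [y/2] ≠ O`.
No Ihara lemma, no Hecke property of `F`, no restriction on the factor types. [cite: MazurTateTeitelbaum1986Invent, §I.10 (10.1) and §I.13]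
[cite: GreenbergVatsal2000, §1 (8)–(10), Prop. (2.4), §3 Remark 3.4] [cite: CremonaAlgorithms1997, §2.4, §2.8, §2.10] [cite: Manin1972, Prop. 1.4 and Thm. 1.6] -/
theorem exists_jacobiMapForm_factorForm_half_ne_zero
    (hΩu : realPeriodRat_eq_unit_mul_plusPeriod_two)
    (W : WeierstrassCurve ℚ) [W.IsElliptic] [W.IsGloballyMinimal] (hord : IsOrdinaryAt W 2) (ht : ∀ x : ℚ, ¬ HasRationalTwoTorsionX W x)
    [NeZero (W.conductorNorm ℤ)] {f : CuspForm (Gamma0 (W.conductorNorm ℤ)) 2} (hf : IsNewformOf W f)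
    {G : IwasawaAlgebra 2} (hG : IsEvenBranchLiftAtTwo W f G)
    (D : ModularParametrizationData W (W.conductorNorm ℤ)) (hc : Odd D.c)
    (ρ σ : ℕ → ℤ) (e : ℕ → ℕ) (S : Finset ℕ) (hS : ∀ ℓ ∈ S, ℓ.Prime) (hS2 : ∀ ℓ ∈ S, ℓ ≠ 2)
    (hρ : ∀ ℓ ∈ S, e ℓ = 0 → ρ ℓ = 0) (hσ : ∀ ℓ ∈ S, e ℓ ≤ 1 → σ ℓ = 0)
    (L : ℕ) [NeZero L] (hL : Odd L) (hNL : W.conductorNorm ℤ * ∏ ℓ ∈ S, ℓ ^ e ℓ ∣ L)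
    (F : CuspForm (Gamma0 L) 2)
    (hF : ∀ s : ℚ, modularSymbol F s =
      ((∏ ℓ ∈ S, (MonoidAlgebra.single 1 (1 : ℂ) + MonoidAlgebra.single ℓ ((ρ ℓ : ℤ) : ℂ) +
        MonoidAlgebra.single (ℓ ^ 2) ((σ ℓ : ℤ) : ℂ)) : MonoidAlgebra ℂ ℕ).coeff.sum fun m a ↦ a * modularSymbol D.f ((m : ℚ) * s)))
    (hg : ∀ φ ∈ periodHomology L, (D.c : ℂ) * φ F ∈ D.L.lattice) :
    ∃ y ∈ periodHomology L, D.jacobiMapForm L F hg (Submodule.Quotient.mk ((2 : ℂ)⁻¹ • y)) ≠ 0 := by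
  -- the datum's newform IS `f`
  have hDf : D.f = f := eq_of_forall_cuspCoeff_eq_gamma0 fun n ↦ by rw [D.isNewformOf.2 n, hf.2 n]
  have hirr := Summit.BirchSwinnertonDyer.BirchSwinnertonDyer.Theorems.AlignedTransportAtTwoSeed.irr_two_of_forall_not_hasRationalTwoTorsionX W ht
  obtain ⟨u, hu, hΩ⟩ := hΩu W hord.1 hirr D.f D.isNewformOf
  have hG' : IsEvenBranchLiftAtTwo W D.f G := by rw [hDf]; exact hG
  -- the list of data and the factor `μ = 0` certificate for the table of `D.f`
  have hlS : ∀ t ∈ (S.toList.map (fun ℓ ↦ (ℓ, ρ ℓ, σ ℓ))), t.1.Prime ∧ t.1 ≠ 2 := by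
    intro t ht'
    rw [List.mem_map] at ht'
    obtain ⟨ℓ, hℓ, rfl⟩ := ht'
    rw [Finset.mem_toList] at hℓ
    exact ⟨hS ℓ hℓ, hS2 ℓ hℓ⟩
  have hcert := exists_factorTable_sub_norm_gt_one W hord ht D.isNewformOf ((S.toList.map (fun ℓ ↦ (ℓ, ρ ℓ, σ ℓ)))) hlS hG'
  exact exists_jacobiMapForm_half_ne_zero_of_foldTable_sub W D hc hu hΩ ρ σ e S (fun ℓ hℓ ↦ (hS ℓ hℓ).ne_zero) hρ hσ L hL hNL F hF hg hcert

end Row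

end Summit.BirchSwinnertonDyer.BirchSwinnertonDyer.Theorems.AlignedTransportAtTwoKilfordKernelLetterCrossLevelFactorMuCertificate

end
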